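import Summits.Ventures.YMGap.RobustBall.UniformPlaquetteDecayRows
import Summits.Ventures.YMGap.Thresholds.CouplingDerivativeTools
import Literature.MathematicalPhysics.QuantumLattice.ContinuumLimitLGT
import HarnessLib

/-!
# Venture YMGap, track ROBUST-BALL (Y2) — Chatterjee's plaquette–plaquette correlation function `f_β(x)` (`plaquetteCorrFn`)
# with an EXPLICIT RATE, uniformly on the balls and at the Wilson point

HONEST FRAMING. WHAT THIS IS: a venture file (cell `pub-ymgap`, track Y2 ROBUST-BALL, seat rb-p1, theorems only). The tree's
statements T14/T15 conclude `HasExponentialDecay (plaquetteCorrFn ρ μ)` — SOME rate. Here the rate is made EXPLICIT and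
member-independent from the uniform currencies: `plaquetteCorrFn ρ μ x` (the un-normalised `Re tr` plaquettes at `0` and `x` in the
`(0,1)` plane, `LatticeGaugeDLR.lean`) equals `N² · Cov_μ(W_0(01), W_x(01))` for the normalised `W_p = (1/N) Re tr U_p`
(`plaquetteCorrFn_eq_sq_mul_cov`; the two plaquette holonomies agree definitionally), so `UniformPlaquetteDecay.lean` applies:
* `PerturbedClustering.hasExponentialDecayRate_plaquetteCorrFn` (`d = 4`) — clustering data `(m, A)`, `m > 0` ⇒ for every DLR state
  `HasExponentialDecayRate (plaquetteCorrFn (fundamentalRep (Fin N)) μ) m` with the explicit constant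
  `N² · max(max(16A,0)e^{2m}(4N³·4N³+1), 4e^{2m})`; tier-2 twin;
* ball level: `UniformMassGapOnBallZd/ZdS/ZdG/LoopBall.hasExponentialDecayRate_plaquetteCorrFn` — THE SAME RATE `m` for every member
  and every DLR state;
* cells (`SU(2)`, `d = 4`): `su2_wilson_hasExponentialDecayRate_plaquetteCorrFn` — for `0 ≤ β_W ≤ 1/12`, EVERY DLR state
  `μ ∈ ymGibbsMeasures (fundamentalRep (Fin 2)) (β_W/2)` has `HasExponentialDecayRate (plaquetteCorrFn … μ) (log 2)` (T15's clause with the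
  rate named on this window); `su2_loopBall_hasExponentialDecayRate_plaquetteCorrFn` — every loop action `‖c‖_{log 2} ≤ 0.143`, every
  `0 ≤ β_W ≤ 1/16`, every DLR state: rate `log 2`.
WHAT THIS IS NOT: the rate is a Dobrushin-comparison LOWER bound on the decay; strong-coupling LATTICE statements, nothing about the
continuum limit or a Clay-sense mass gap.
-/

noncomputable section

open MeasureTheory Filter Function ProbabilityTheory Real
open scoped NNReal
open Literature.Probability.LatticeModels
open Literature.Probability.LatticeModels.DobrushinMetric
open Literature.MathematicalPhysics.QuantumLattice
open Literature.MathematicalPhysics.QuantumFieldTheory hiding ZdEdge Site plaquetteObs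
open Summit.Ventures.YMGap.CouplingResponse (covariance_eq_sub_of_abs_le)

namespace Summit.Ventures.YMGap.RobustBall

variable {d N : ℕ}

/-! ### `plaquetteCorrFn` against the normalised plaquette covariance -/

/-- The un-normalised plaquette observable is `N` times the normalised one: `Re tr U_p = N · ((1/N) Re tr U_p)` (`N ≥ 1`; the two
plaquette holonomies `plaquetteHolonomyZd` / `ZdGaugeConfig.plaquette` agree by definition). [folklore] -/
theorem plaquetteObs_eq_mul_zdPlaquetteObs (hN : 1 ≤ N) (x : Literature.Probability.LatticeModels.Site d) (i j : Fin d)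
    (U : LGConfig d (SUN N)) :
    plaquetteObs (fundamentalRep (Fin N)) x i j U = (N : ℝ) * zdPlaquetteObs (fundamentalRep (Fin N)) x i j U := by
  have hN0 : (N : ℝ) ≠ 0 := by exact_mod_cast (show N ≠ 0 by omega)
  unfold plaquetteObs zdPlaquetteObs
  rw [← mul_assoc, mul_inv_cancel₀ hN0, one_mul]
  rfl

/-- `|Re tr U_p| ≤ N` for `SU(N)`. [folklore] -/
theorem abs_plaquetteObs_le_natCast (hN : 1 ≤ N) (x : Literature.Probability.LatticeModels.Site d) (i j : Fin d)
    (U : LGConfig d (SUN N)) : |plaquetteObs (fundamentalRep (Fin N)) x i j U| ≤ N := by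
  rw [plaquetteObs_eq_mul_zdPlaquetteObs hN, abs_mul, Nat.abs_cast]
  exact mul_le_of_le_one_right (Nat.cast_nonneg _) (abs_zdPlaquetteObs_le fundamentalRep_mem_unitaryGroup x i j U)

/-- **`f(x) = N² · Cov_μ(W_0, W_x)`**: Chatterjee's plaquette–plaquette correlation function of a probability measure is `N²` times the
covariance of the normalised plaquettes at `0` and `x` in the `(0, 1)` plane. [folklore] -/
theorem plaquetteCorrFn_eq_sq_mul_cov [NeZero d] (hN : 1 ≤ N) (μ : Measure (LGConfig d (SUN N))) [IsProbabilityMeasure μ]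
    (x : Literature.Probability.LatticeModels.Site d) :
    plaquetteCorrFn (fundamentalRep (Fin N)) μ x =
      (N : ℝ) ^ 2 * cov[zdPlaquetteObs (fundamentalRep (Fin N)) 0 0 1, zdPlaquetteObs (fundamentalRep (Fin N)) x 0 1; μ] := by
  have hc : Continuous (fundamentalRep (Fin N)) := continuous_fundamentalRep (Fin N)
  have hcov := covariance_eq_sub_of_abs_le (μ := μ) (measurable_plaquetteObs (fundamentalRep (Fin N)) hc 0 0 1)
    (measurable_plaquetteObs (fundamentalRep (Fin N)) hc x 0 1) (abs_plaquetteObs_le_natCast hN 0 0 1)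
    (abs_plaquetteObs_le_natCast hN x 0 1)
  unfold plaquetteCorrFn plaquetteCorr
  rw [← hcov]
  have e1 : plaquetteObs (fundamentalRep (Fin N)) (0 : Literature.Probability.LatticeModels.Site d) 0 1 =
      fun U => (N : ℝ) * zdPlaquetteObs (fundamentalRep (Fin N)) 0 0 1 U := funext fun U => plaquetteObs_eq_mul_zdPlaquetteObs hN _ _ _ U
  have e2 : plaquetteObs (fundamentalRep (Fin N)) x 0 1 =
      fun U => (N : ℝ) * zdPlaquetteObs (fundamentalRep (Fin N)) x 0 1 U := funext fun U => plaquetteObs_eq_mul_zdPlaquetteObs hN _ _ _ U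
  rw [e1, e2, covariance_const_mul_left, covariance_const_mul_right]
  ring

/-! ### Explicit decay rate of `plaquetteCorrFn` from clustering data (`d = 4`) -/

section Member

variable {β m A : ℝ} {W : Potential (ZdEdge 4) (Matrix.specialUnitaryGroup (Fin N) ℂ)}
  {supp : Finset (ZdEdge 4) → Finset (Finset (ZdEdge 4))}

/-- **Explicit rate for Chatterjee's `f_β`** (`d = 4`, `N ≥ 1`): clustering data `(m, A)` with `m > 0` give, for every DLR state `μ`,
`HasExponentialDecayRate (plaquetteCorrFn (fundamentalRep (Fin N)) μ) m` with constant `N²·max(max(16A,0)e^{2m}(4N³·4N³+1), 4e^{2m})`. [folklore] -/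
theorem PerturbedClustering.hasExponentialDecayRate_plaquetteCorrFn (hN : 1 ≤ N) (h : PerturbedClustering 4 N β W supp m A) (hm : 0 < m)
    {μ : Measure (LGConfig 4 (SUN N))} (hμ : μ ∈ perturbedGibbsMeasures (d := 4) (fundamentalRep (Fin N)) (N * β) W supp) :
    HasExponentialDecayRate (plaquetteCorrFn (fundamentalRep (Fin N)) μ) m := by
  have hμ' : IsGibbsMeasure (perturbedYM (d := 4) (fundamentalRep (Fin N)) (N * β) W supp) μ := hμ
  haveI := hμ'.isProbabilityMeasure
  refine ⟨hm, (N : ℝ) ^ 2 * max (max (A * (4 : ℕ) ^ 2) 0 * Real.exp (2 * m) *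
      (((4 * (N : ℝ≥0) ^ 3 : ℝ≥0) : ℝ) * ((4 * (N : ℝ≥0) ^ 3 : ℝ≥0) : ℝ) + 1)) (4 * Real.exp (2 * m)), fun x => ?_⟩
  have h01 : (0 : Fin 4) < 1 := by decide
  have hb := h.abs_cov_plaquette_le hm hμ 0 x h01 h01
  rw [zero_sub, norm_neg] at hb
  rw [plaquetteCorrFn_eq_sq_mul_cov hN μ x, abs_mul, abs_pow, Nat.abs_cast, mul_assoc]
  exact mul_le_mul_of_nonneg_left hb (by positivity)

/-- The tier-2 twin. [folklore] -/
theorem PerturbedClusteringS.hasExponentialDecayRate_plaquetteCorrFn (hN : 1 ≤ N) (h : PerturbedClusteringS 4 N β W m A) (hm : 0 < m)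
    {μ : Measure (LGConfig 4 (SUN N))} (hμ : μ ∈ perturbedGibbsMeasuresS (d := 4) (fundamentalRep (Fin N)) (N * β) W) :
    HasExponentialDecayRate (plaquetteCorrFn (fundamentalRep (Fin N)) μ) m := by
  have hμ' : IsGibbsMeasure (perturbedYMS (d := 4) (fundamentalRep (Fin N)) (N * β) W) μ := hμ
  haveI := hμ'.isProbabilityMeasure
  refine ⟨hm, (N : ℝ) ^ 2 * max (max (A * (4 : ℕ) ^ 2) 0 * Real.exp (2 * m) *
      (((4 * (N : ℝ≥0) ^ 3 : ℝ≥0) : ℝ) * ((4 * (N : ℝ≥0) ^ 3 : ℝ≥0) : ℝ) + 1)) (4 * Real.exp (2 * m)), fun x => ?_⟩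
  have h01 : (0 : Fin 4) < 1 := by decide
  have hb := h.abs_cov_plaquette_le hm hμ 0 x h01 h01
  rw [zero_sub, norm_neg] at hb
  rw [plaquetteCorrFn_eq_sq_mul_cov hN μ x, abs_mul, abs_pow, Nat.abs_cast, mul_assoc]
  exact mul_le_mul_of_nonneg_left hb (by positivity)

end Member

/-! ### The balls: the same rate for every member and every DLR state -/

section Balls

variable {β ε₀ ε₁ R a Λ t w ε m A : ℝ}

/-- **TIER-1 BALL**: every member of `MemBallZd ε₀ ε₁ R`, every DLR state: `HasExponentialDecayRate (plaquetteCorrFn …) m`. [folklore] -/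
theorem UniformMassGapOnBallZd.hasExponentialDecayRate_plaquetteCorrFn (hN : 1 ≤ N) (h : UniformMassGapOnBallZd 4 N β ε₀ ε₁ R m A)
    {W : Potential (ZdEdge 4) (Matrix.specialUnitaryGroup (Fin N) ℂ)} {supp : Finset (ZdEdge 4) → Finset (Finset (ZdEdge 4))}
    (hW : MemBallZd ε₀ ε₁ R W supp) {μ : Measure (LGConfig 4 (SUN N))}
    (hμ : μ ∈ perturbedGibbsMeasures (d := 4) (fundamentalRep (Fin N)) (N * β) W supp) :
    HasExponentialDecayRate (plaquetteCorrFn (fundamentalRep (Fin N)) μ) m :=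
  (h.2 W supp hW).2.hasExponentialDecayRate_plaquetteCorrFn hN h.1 hμ

/-- **TIER-2 BALL.** [folklore] -/
theorem UniformMassGapOnBallZdS.hasExponentialDecayRate_plaquetteCorrFn (hN : 1 ≤ N) (h : UniformMassGapOnBallZdS 4 N β a Λ t m A)
    {W : Potential (ZdEdge 4) (Matrix.specialUnitaryGroup (Fin N) ℂ)} (hW : MemBallZdS a Λ t W)
    {μ : Measure (LGConfig 4 (SUN N))} (hμ : μ ∈ perturbedGibbsMeasuresS (d := 4) (fundamentalRep (Fin N)) (N * β) W) :
    HasExponentialDecayRate (plaquetteCorrFn (fundamentalRep (Fin N)) μ) m :=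
  (h.2 W hW).2.hasExponentialDecayRate_plaquetteCorrFn hN h.1 hμ

/-- **GAUGE BALL** (ds-2). [folklore] -/
theorem UniformMassGapOnBallZdG.hasExponentialDecayRate_plaquetteCorrFn (hN : 1 ≤ N) {R : ℕ}
    (h : UniformMassGapOnBallZdG 4 N β ε₀ ε₁ R m A)
    {W : Potential (ZdEdge 4) (SUN N)} {supp : Finset (ZdEdge 4) → Finset (Finset (ZdEdge 4))}
    (hW : MemBallZdG ε₀ ε₁ R W supp) {μ : Measure (LGConfig 4 (SUN N))}
    (hμ : μ ∈ perturbedGibbsMeasures (d := 4) (fundamentalRep (Fin N)) (N * β) W supp) :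
    HasExponentialDecayRate (plaquetteCorrFn (fundamentalRep (Fin N)) μ) m :=
  (h.2 W supp hW).2.hasExponentialDecayRate_plaquetteCorrFn hN h.1 hμ

/-- **LOOP-ACTION NORM BALL `‖c‖_w ≤ ε`.** [folklore] -/
theorem UniformMassGapOnLoopBall.hasExponentialDecayRate_plaquetteCorrFn (hN : 1 ≤ N) (h : UniformMassGapOnLoopBall 4 N β w ε m A)
    {ι : Type} {γ : ι → ZdLoop 4} {c : ι → ℝ} (hfin : ∀ X, {i | walkEdges (γ i).walk = X}.Finite) (hn : LoopNormLE w γ c ε)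
    {μ : Measure (LGConfig 4 (SUN N))}
    (hμ : μ ∈ perturbedGibbsMeasuresS (d := 4) (fundamentalRep (Fin N)) (N * β) (loopFamilyAction (d := 4) N γ c)) :
    HasExponentialDecayRate (plaquetteCorrFn (fundamentalRep (Fin N)) μ) m :=
  (h.2 ι γ c hfin hn).2.hasExponentialDecayRate_plaquetteCorrFn hN h.1 hμ

end Balls

/-! ### Cells: `SU(2)`, `d = 4` -/

/-- **THE WILSON POINT WITH ITS RATE NAMED** (T15's clause on `[0, 1/12]`, explicit): for `0 ≤ β_W ≤ 1/12`, EVERY DLR state `μ` of `SU(2)`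
lattice Yang–Mills on `ℤ⁴` at bare coupling `β_W/2` has `HasExponentialDecayRate (plaquetteCorrFn (fundamentalRep (Fin 2)) μ) (log 2)`.
[folklore] -/
theorem su2_wilson_hasExponentialDecayRate_plaquetteCorrFn {βW : ℝ} (h0 : 0 ≤ βW) (h : βW ≤ 1 / 12)
    {μ : Measure (LGConfig 4 (SUN 2))} (hμ : μ ∈ ymGibbsMeasures (d := 4) (fundamentalRep (Fin 2)) (βW / 2)) :
    HasExponentialDecayRate (plaquetteCorrFn (fundamentalRep (Fin 2)) μ) (Real.log 2) := by
  have hμ' : μ ∈ perturbedGibbsMeasures (d := 4) (fundamentalRep (Fin 2)) (2 * (βW / 4)) 0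
      (fun _ => (∅ : Finset (Finset (ZdEdge 4)))) := by
    rw [perturbedGibbsMeasures_zero]
    have e : (2 : ℝ) * (βW / 4) = βW / 2 := by ring
    rwa [e]
  exact (su2_wilson_clustering_upTo_oneTwelfth h0 h).hasExponentialDecayRate_plaquetteCorrFn (N := 2) (by norm_num)
    (Real.log_pos one_lt_two) hμ'

/-- For `1/12 ≤ β_W < 1/6` the rate is `1 − 6β_W` (linear closing of the single-link door). [folklore] -/
theorem su2_wilson_hasExponentialDecayRate_plaquetteCorrFn_lt_oneSixth {βW : ℝ} (h0 : 1 / 12 ≤ βW) (h : βW < 1 / 6)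
    {μ : Measure (LGConfig 4 (SUN 2))} (hμ : μ ∈ ymGibbsMeasures (d := 4) (fundamentalRep (Fin 2)) (βW / 2)) :
    HasExponentialDecayRate (plaquetteCorrFn (fundamentalRep (Fin 2)) μ) (1 - 6 * βW) := by
  have hμ' : μ ∈ perturbedGibbsMeasures (d := 4) (fundamentalRep (Fin 2)) (2 * (βW / 4)) 0
      (fun _ => (∅ : Finset (Finset (ZdEdge 4)))) := by
    rw [perturbedGibbsMeasures_zero]
    have e : (2 : ℝ) * (βW / 4) = βW / 2 := by ring
    rwa [e]
  exact (su2_wilson_clustering_lt_oneSixth h0 h).hasExponentialDecayRate_plaquetteCorrFn (N := 2) (by norm_num) (by linarith) hμ'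

/-- **THE LOOP BALL**: every generic Wilson-type loop action with finite carrier fibres and `‖c‖_{log 2} ≤ 0.143`, every
`0 ≤ β_W ≤ 1/16`, every DLR state: `HasExponentialDecayRate (plaquetteCorrFn …) (log 2)` — one rate for the whole ball. [folklore] -/
theorem su2_loopBall_hasExponentialDecayRate_plaquetteCorrFn {βW : ℝ} (h0 : 0 ≤ βW) (h : βW ≤ 1 / 16)
    {ι : Type} {γ : ι → ZdLoop 4} {c : ι → ℝ} (hfin : ∀ X, {i | walkEdges (γ i).walk = X}.Finite)
    (hn : LoopNormLE (Real.log 2) γ c (143 / 1000)) {μ : Measure (LGConfig 4 (SUN 2))}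
    (hμ : μ ∈ perturbedGibbsMeasuresS (d := 4) (fundamentalRep (Fin 2)) (2 * (βW / 4)) (loopFamilyAction (d := 4) 2 γ c)) :
    HasExponentialDecayRate (plaquetteCorrFn (fundamentalRep (Fin 2)) μ) (Real.log 2) :=
  (su2_uniformLoopBall_upTo_1_16 h0 h).hasExponentialDecayRate_plaquetteCorrFn (by norm_num) hfin hn hμ

end Summit.Ventures.YMGap.RobustBall

end
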